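import Literature.Claims.NS.ClayR3EnstrophyBridge
import HarnessLib

/-!
# Clay (A) reference — DATA-ONLY a priori bounds stated for the Beale–Kato–Majda class on CLOSED
# slabs already give (A)

Companion to `ClayR3BlowupAlternative.lean`, `ClayR3BKMBridge.lean`, `ClayR3EnstrophyBridge.lean`
(same namespace). Those files state «(A) ⇔ a priori bound» for FINITE-ENERGY classical solutions on
HALF-OPEN slabs `[0, T) × ℝ³`, the class in which Leray's alternative produces the maximal solution.
Manuscripts (and the D-0090 skeletons rendering them, e.g. `Ruzmaikina2008.IsSolution`,
`Durmagambetov2015`, `Lindgren2012`, `Kyritsis2021/2022`, `Kampen2014`, `Iotti2011`, `Chae2007`) usually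
print their a priori estimate for a SMALLER class — «strong»/«regular» solutions on a CLOSED slab
`[0, T]`, rendered in the tree as classical solutions with all `L²` Sobolev seminorms bounded
(`HasBoundedSobolevNormsOn (Icc 0 T) u`, the Beale–Kato–Majda / Tao `H^∞` class) — with a constant
depending on the DATUM ONLY (not on `T`). This file records that such a data-only bound is enough:
the maximal finite-energy classical solution from a class-(4) datum lies in that class on every closed
sub-slab `[0, T''] ⊂ [0, T*)` (`hasBoundedSobolevNormsOn_Icc_of_finiteEnergy_Ico`, Tao's Cor. 11.1),
so a `T`-independent bound transfers to `[0, T*)` and the alternative closes.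

* `clayR3_solvable_of_bkmClass_velocityBound` / `…_gradientBound` / `…_vorticityBound` /
  `…_enstrophyBound` — for ONE datum `u₀` (smooth, divergence free, class (4)) and `μ > 0`: if one
  constant bounds `sup|u|` (resp. `sup‖∇u‖`, `sup|curl u|`, `∫|curl u(t)|²`) on `[0, T]` for EVERY
  `T > 0` and EVERY classical solution on `[0, T] × ℝ³` from `u₀` in the BKM class, then `(μ, 0, u₀)`
  is Clay-solvable;
* `clayR3_solvable_of_aprioriBKM_datum` — the per-datum BKM door used for the two pointwise forms
  (finite `∫₀ᵀ sup|curl u|` along every finite-energy classical solution from `u₀` on a half-open slab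
  ⇒ solvable);
* `clayR3_regularityAt_of_bkmClass_velocityBound` / `…_gradientBound` / `…_vorticityBound` /
  `…_enstrophyBound` and `clayR3_regularity_of_bkmClass_…` — the same for all data: **(A)** (at `μ`,
  hence at every viscosity, `clayR3_regularityAt_iff`).

Usage on a CARD (§3/§5): a REG claim of the form «for every T and every strong solution on [0,T],
sup|u| ≤ C(u₀)» (resp. gradient / vorticity / enstrophy) IS (A) by these theorems even though it is
printed for the BKM/strong class on closed slabs — no Δ5 «class» delta arises from THAT difference; a
`T`-DEPENDENT constant `C(u₀, T)` on closed slabs is NOT covered here (it does not exclude blow-up at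
`T*`; use the half-open forms of the companion files, which is what such a claim must then establish).

## References

* C. L. Fefferman, CMI 2006, (A) with (4)–(7) p. 2. [FeffermanClay2006]
* J. T. Beale, T. Kato, A. Majda, Comm. Math. Phys. 94 (1984), Thm. 1 and Corollary. [BealeKatoMajda1984]
* T. Tao, Anal. PDE 6 (2013) = arXiv:1108.1165, Thm 5.4, Cor. 11.1, Cor. 11.4. [Tao2011]
* J. Leray, Acta Math. 63 (1934), §33, §20. [Leray1934]

WHAT THIS IS NOT: not a claim about NS regularity or blow-up; not a claim about any author beyond
the typed locator.
-/

open scoped ContDiff ENNReal NNReal Topology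

namespace Literature.Claims.NS.ClayVariants

open Set Filter MeasureTheory Function Literature.Analysis Literature.Analysis.FluidPDE

noncomputable section

variable {μ : ℝ} {u₀ : EuclideanSpace ℝ (Fin 3) → EuclideanSpace ℝ (Fin 3)}

/-! ## The per-datum BKM door -/

/-- **Per-datum Beale–Kato–Majda door**: if along EVERY finite-energy classical solution of the
unforced system from `u₀` (smooth, divergence free, class (4)) on a half-open slab `[0, T) × ℝ³` the
BKM integral `∫₀ᵀ sup_x |curl u|` is finite, then `(μ, 0, u₀)` is Clay-solvable (the maximal solution
of `clayR3_solvable_or_supBlowup` would continue in the Sobolev class past `T*` by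
`beale_kato_majda_holds` — a finite-energy classical solution on the closed slab `[0, T*]`, excluded).
[cite: FeffermanClay2006, (A) with (4) (6) (7) p. 2] [cite: BealeKatoMajda1984, Thm. 1 and Corollary] -/
theorem clayR3_solvable_of_aprioriBKM_datum (hμ : 0 < μ) (hu₀ : ContDiff ℝ ∞ u₀)
    (hdiv : NSWave0.IsDivFree u₀) (hdec : HasRapidSpatialDecay u₀)
    (hbkm : ∀ (T : ℝ) (u : ℝ → EuclideanSpace ℝ (Fin 3) → EuclideanSpace ℝ (Fin 3))
      (p : ℝ → EuclideanSpace ℝ (Fin 3) → ℝ),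
      IsClassicalNSSolutionOn (Ico 0 T) μ 0 u p → u 0 = u₀ →
        (∃ A : ℝ≥0∞, A < ⊤ ∧ ∀ t ∈ Ico 0 T, ∫⁻ x, ‖u t x‖ₑ ^ 2 ≤ A) →
          (∫⁻ t in Ioo 0 T, ⨆ x, ‖curl (u t) x‖ₑ) < ⊤) :
    clayR3.Solvable μ 0 u₀ := by
  rcases clayR3_solvable_or_supBlowup hμ hu₀ hdiv hdec with
    hsol | ⟨Ts, hTs, u, p, hcl, hu0, hE, -, hmax⟩
  · exact hsol
  · exfalso
    have hreg := hasBoundedSobolevNormsOn_Icc_of_finiteEnergy_Ico hμ hdec hcl hu0 hE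
    obtain ⟨T', hT', u', p', hcl', hsob', hagr⟩ :=
      (beale_kato_majda_holds hμ.le hTs hcl hreg).2 (hbkm Ts u p hcl hu0 hE)
    have hcl'' : IsClassicalNSSolutionOn (Icc 0 Ts) μ 0 u' p' :=
      hcl'.mono (Icc_subset_Ico_right hT') (uniqueDiffOn_Icc hTs)
    have hu'0 : u' 0 = u₀ := (hagr 0 ⟨le_rfl, hTs⟩).trans hu0
    obtain ⟨C, hC⟩ := hsob' 0
    refine hmax Ts le_rfl u' p' hcl'' hu'0 ⟨C, ENNReal.coe_lt_top, fun t ht => ?_⟩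
    have h := hC t ht
    have h2 : ∀ x, ‖iteratedFDeriv ℝ 0 (u' t) x‖ₑ = ‖u' t x‖ₑ := fun x =>
      enorm_eq_iff_norm_eq.2 norm_iteratedFDeriv_zero
    simp_rw [h2] at h
    exact h

/-- Transfer of a data-only bound stated for the BKM class on closed slabs to a finite-energy
classical solution on a half-open slab (pointwise quantities). [folklore] -/
private theorem bound_Ico_of_bkmClass_bound (hμ : 0 < μ) (hdec : HasRapidSpatialDecay u₀)
    {Q : (EuclideanSpace ℝ (Fin 3) → EuclideanSpace ℝ (Fin 3)) → EuclideanSpace ℝ (Fin 3) → ℝ} {M : ℝ}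
    (hM : ∀ T : ℝ, 0 < T → ∀ (u : ℝ → EuclideanSpace ℝ (Fin 3) → EuclideanSpace ℝ (Fin 3))
      (p : ℝ → EuclideanSpace ℝ (Fin 3) → ℝ),
      IsClassicalNSSolutionOn (Icc 0 T) μ 0 u p → u 0 = u₀ → HasBoundedSobolevNormsOn (Icc 0 T) u →
        ∀ t ∈ Icc 0 T, ∀ x, Q (u t) x ≤ M)
    {T : ℝ} {u : ℝ → EuclideanSpace ℝ (Fin 3) → EuclideanSpace ℝ (Fin 3)}
    {p : ℝ → EuclideanSpace ℝ (Fin 3) → ℝ}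
    (hcl : IsClassicalNSSolutionOn (Ico 0 T) μ 0 u p) (hu0 : u 0 = u₀)
    (hE : ∃ A : ℝ≥0∞, A < ⊤ ∧ ∀ t ∈ Ico 0 T, ∫⁻ x, ‖u t x‖ₑ ^ 2 ≤ A) :
    ∀ t ∈ Ico 0 T, ∀ x, Q (u t) x ≤ M := by
  intro t ht x
  have hT'' : 0 < (t + T) / 2 := by linarith [ht.1, ht.2]
  have htT'' : t ≤ (t + T) / 2 := by linarith [ht.2]
  have hT''T : (t + T) / 2 < T := by linarith [ht.2]
  exact hM _ hT'' u p (hcl.mono (Icc_subset_Ico_right hT''T) (uniqueDiffOn_Icc hT'')) hu0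
    (hasBoundedSobolevNormsOn_Icc_of_finiteEnergy_Ico hμ hdec hcl hu0 hE _ hT''T) t ⟨ht.1, htT''⟩ x

/-! ## Data-only bounds in the BKM class on closed slabs ⇒ solvability of the datum -/

/-- **A data-only VELOCITY bound in the BKM class gives Clay solvability**: if ONE constant `M`
bounds `|u(t,x)|` on `[0, T] × ℝ³` for every `T > 0` and every classical solution `(u, p)` of the
unforced system on `[0, T] × ℝ³` with `u 0 = u₀` and all `L²` Sobolev seminorms bounded on `[0, T]`,
then `(μ, 0, u₀)` is Clay-solvable (`μ > 0`, `u₀` smooth divergence free of class (4)).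
[cite: FeffermanClay2006, (A) with (4) (6) (7) p. 2] [cite: Leray1934, §33] [cite: Tao2011, Cor. 11.1, Cor. 11.4] -/
theorem clayR3_solvable_of_bkmClass_velocityBound (hμ : 0 < μ) (hu₀ : ContDiff ℝ ∞ u₀)
    (hdiv : NSWave0.IsDivFree u₀) (hdec : HasRapidSpatialDecay u₀) {M : ℝ}
    (hM : ∀ T : ℝ, 0 < T → ∀ (u : ℝ → EuclideanSpace ℝ (Fin 3) → EuclideanSpace ℝ (Fin 3))
      (p : ℝ → EuclideanSpace ℝ (Fin 3) → ℝ),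
      IsClassicalNSSolutionOn (Icc 0 T) μ 0 u p → u 0 = u₀ → HasBoundedSobolevNormsOn (Icc 0 T) u →
        ∀ t ∈ Icc 0 T, ∀ x, ‖u t x‖ ≤ M) :
    clayR3.Solvable μ 0 u₀ := by
  by_contra hno
  obtain ⟨T, -, u, p, hcl, hu0, hE, hb⟩ :=
    (not_clayR3_solvable_iff_exists_supBlowup hμ hu₀ hdiv hdec).1 hno
  have hbd := bound_Ico_of_bkmClass_bound (Q := fun v x => ‖v x‖) hμ hdec hM hcl hu0 hE
  obtain ⟨t, ht, x, hMx⟩ := hb M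
  exact absurd hMx (not_lt.2 (hbd t ht x))

/-- **A data-only VORTICITY bound in the BKM class gives Clay solvability** (the pointwise
Beale–Kato–Majda form). [cite: FeffermanClay2006, (A) with (4) (6) (7) p. 2] [cite: BealeKatoMajda1984, Thm. 1 and Corollary] -/
theorem clayR3_solvable_of_bkmClass_vorticityBound (hμ : 0 < μ) (hu₀ : ContDiff ℝ ∞ u₀)
    (hdiv : NSWave0.IsDivFree u₀) (hdec : HasRapidSpatialDecay u₀) {M : ℝ}
    (hM : ∀ T : ℝ, 0 < T → ∀ (u : ℝ → EuclideanSpace ℝ (Fin 3) → EuclideanSpace ℝ (Fin 3))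
      (p : ℝ → EuclideanSpace ℝ (Fin 3) → ℝ),
      IsClassicalNSSolutionOn (Icc 0 T) μ 0 u p → u 0 = u₀ → HasBoundedSobolevNormsOn (Icc 0 T) u →
        ∀ t ∈ Icc 0 T, ∀ x, ‖curl (u t) x‖ ≤ M) :
    clayR3.Solvable μ 0 u₀ := by
  refine clayR3_solvable_of_aprioriBKM_datum hμ hu₀ hdiv hdec fun T u p hcl hu0 hE => ?_
  have hbd := bound_Ico_of_bkmClass_bound (Q := fun v x => ‖curl v x‖) hμ hdec hM hcl hu0 hE
  have hle : (∫⁻ t in Ioo 0 T, ⨆ x, ‖curl (u t) x‖ₑ) ≤ ∫⁻ _t in Ioo 0 T, ENNReal.ofReal M := by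
    refine setLIntegral_mono' measurableSet_Ioo fun t ht => iSup_le fun x => ?_
    rw [← ofReal_norm]
    exact ENNReal.ofReal_le_ofReal (hbd t (Ioo_subset_Ico_self ht) x)
  refine lt_of_le_of_lt hle ?_
  rw [setLIntegral_const]
  exact ENNReal.mul_lt_top ENNReal.ofReal_lt_top measure_Ioo_lt_top

/-- **A data-only GRADIENT bound in the BKM class gives Clay solvability** (`|curl v| ≤ κ‖∇v‖`).
[cite: FeffermanClay2006, (A) with (4) (6) (7) p. 2] [cite: BealeKatoMajda1984, Thm. 1 and Corollary] -/
theorem clayR3_solvable_of_bkmClass_gradientBound (hμ : 0 < μ) (hu₀ : ContDiff ℝ ∞ u₀)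
    (hdiv : NSWave0.IsDivFree u₀) (hdec : HasRapidSpatialDecay u₀) {D : ℝ}
    (hD : ∀ T : ℝ, 0 < T → ∀ (u : ℝ → EuclideanSpace ℝ (Fin 3) → EuclideanSpace ℝ (Fin 3))
      (p : ℝ → EuclideanSpace ℝ (Fin 3) → ℝ),
      IsClassicalNSSolutionOn (Icc 0 T) μ 0 u p → u 0 = u₀ → HasBoundedSobolevNormsOn (Icc 0 T) u →
        ∀ t ∈ Icc 0 T, ∀ x, ‖fderiv ℝ (u t) x‖ ≤ D) :
    clayR3.Solvable μ 0 u₀ :=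
  clayR3_solvable_of_bkmClass_vorticityBound hμ hu₀ hdiv hdec (M := ‖curlCLM‖ * D)
    fun T hT u p hcl hu0 hsob t ht x =>
      (norm_curl_le (u t) x).trans
        (mul_le_mul_of_nonneg_left (hD T hT u p hcl hu0 hsob t ht x)
          (ContinuousLinearMap.opNorm_nonneg curlCLM))

/-- **A data-only ENSTROPHY bound in the BKM class gives Clay solvability** (`∫|curl u(t)|² ≤ M` on
`[0, T]` for every `T` and every BKM-class solution from `u₀`; Leray's `H¹` continuation principle
through `not_clayR3_solvable_iff_exists_enstrophyBlowup`).
[cite: FeffermanClay2006, (A) with (4) (6) (7) p. 2] [cite: Leray1934, §33, §20] [cite: Tao2011, Cor. 11.1, Cor. 11.4] -/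
theorem clayR3_solvable_of_bkmClass_enstrophyBound (hμ : 0 < μ) (hu₀ : ContDiff ℝ ∞ u₀)
    (hdiv : NSWave0.IsDivFree u₀) (hdec : HasRapidSpatialDecay u₀) {M : ℝ}
    (hM : ∀ T : ℝ, 0 < T → ∀ (u : ℝ → EuclideanSpace ℝ (Fin 3) → EuclideanSpace ℝ (Fin 3))
      (p : ℝ → EuclideanSpace ℝ (Fin 3) → ℝ),
      IsClassicalNSSolutionOn (Icc 0 T) μ 0 u p → u 0 = u₀ → HasBoundedSobolevNormsOn (Icc 0 T) u →
        ∀ t ∈ Icc 0 T, ∫ x, ‖curl (u t) x‖ ^ 2 ≤ M) :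
    clayR3.Solvable μ 0 u₀ := by
  by_contra hno
  obtain ⟨T, -, u, p, hcl, hu0, hE, hb⟩ :=
    (not_clayR3_solvable_iff_exists_enstrophyBlowup hμ hu₀ hdiv hdec).1 hno
  obtain ⟨t, ht, hMt⟩ := hb M
  have hT'' : 0 < (t + T) / 2 := by linarith [ht.1, ht.2]
  have htT'' : t ≤ (t + T) / 2 := by linarith [ht.2]
  have hT''T : (t + T) / 2 < T := by linarith [ht.2]
  have h := hM _ hT'' u p (hcl.mono (Icc_subset_Ico_right hT''T) (uniqueDiffOn_Icc hT'')) hu0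
    (hasBoundedSobolevNormsOn_Icc_of_finiteEnergy_Ico hμ hdec hcl hu0 hE _ hT''T) t ⟨ht.1, htT''⟩
  exact absurd hMt (not_lt.2 h)

/-! ## Data-only bounds in the BKM class for all data ⇒ (A) -/

/-- **(A) at `μ` from data-only VELOCITY bounds in the BKM class on closed slabs** (one constant per
datum, uniform in `T`). [cite: FeffermanClay2006, (A) with (4) (6) (7) p. 2] [cite: Leray1934, §33] -/
theorem clayR3_regularityAt_of_bkmClass_velocityBound (hμ : 0 < μ)
    (h : ∀ (u₀ : EuclideanSpace ℝ (Fin 3) → EuclideanSpace ℝ (Fin 3)), ContDiff ℝ ∞ u₀ →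
      NSWave0.IsDivFree u₀ → HasRapidSpatialDecay u₀ →
      ∃ M : ℝ, ∀ T : ℝ, 0 < T → ∀ (u : ℝ → EuclideanSpace ℝ (Fin 3) → EuclideanSpace ℝ (Fin 3))
        (p : ℝ → EuclideanSpace ℝ (Fin 3) → ℝ),
        IsClassicalNSSolutionOn (Icc 0 T) μ 0 u p → u 0 = u₀ → HasBoundedSobolevNormsOn (Icc 0 T) u →
          ∀ t ∈ Icc 0 T, ∀ x, ‖u t x‖ ≤ M) :
    clayR3.RegularityAt μ := fun u₀ hu₀ hdiv hdec => by
  obtain ⟨M, hM⟩ := h u₀ hu₀ hdiv hdec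
  exact clayR3_solvable_of_bkmClass_velocityBound hμ hu₀ hdiv hdec hM

/-- **(A) at `μ` from data-only GRADIENT bounds in the BKM class on closed slabs.**
[cite: FeffermanClay2006, (A) with (4) (6) (7) p. 2] [cite: BealeKatoMajda1984, Thm. 1 and Corollary] -/
theorem clayR3_regularityAt_of_bkmClass_gradientBound (hμ : 0 < μ)
    (h : ∀ (u₀ : EuclideanSpace ℝ (Fin 3) → EuclideanSpace ℝ (Fin 3)), ContDiff ℝ ∞ u₀ →
      NSWave0.IsDivFree u₀ → HasRapidSpatialDecay u₀ →
      ∃ D : ℝ, ∀ T : ℝ, 0 < T → ∀ (u : ℝ → EuclideanSpace ℝ (Fin 3) → EuclideanSpace ℝ (Fin 3))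
        (p : ℝ → EuclideanSpace ℝ (Fin 3) → ℝ),
        IsClassicalNSSolutionOn (Icc 0 T) μ 0 u p → u 0 = u₀ → HasBoundedSobolevNormsOn (Icc 0 T) u →
          ∀ t ∈ Icc 0 T, ∀ x, ‖fderiv ℝ (u t) x‖ ≤ D) :
    clayR3.RegularityAt μ := fun u₀ hu₀ hdiv hdec => by
  obtain ⟨D, hD⟩ := h u₀ hu₀ hdiv hdec
  exact clayR3_solvable_of_bkmClass_gradientBound hμ hu₀ hdiv hdec hD

/-- **(A) at `μ` from data-only VORTICITY bounds in the BKM class on closed slabs.**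
[cite: FeffermanClay2006, (A) with (4) (6) (7) p. 2] [cite: BealeKatoMajda1984, Thm. 1 and Corollary] -/
theorem clayR3_regularityAt_of_bkmClass_vorticityBound (hμ : 0 < μ)
    (h : ∀ (u₀ : EuclideanSpace ℝ (Fin 3) → EuclideanSpace ℝ (Fin 3)), ContDiff ℝ ∞ u₀ →
      NSWave0.IsDivFree u₀ → HasRapidSpatialDecay u₀ →
      ∃ M : ℝ, ∀ T : ℝ, 0 < T → ∀ (u : ℝ → EuclideanSpace ℝ (Fin 3) → EuclideanSpace ℝ (Fin 3))
        (p : ℝ → EuclideanSpace ℝ (Fin 3) → ℝ),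
        IsClassicalNSSolutionOn (Icc 0 T) μ 0 u p → u 0 = u₀ → HasBoundedSobolevNormsOn (Icc 0 T) u →
          ∀ t ∈ Icc 0 T, ∀ x, ‖curl (u t) x‖ ≤ M) :
    clayR3.RegularityAt μ := fun u₀ hu₀ hdiv hdec => by
  obtain ⟨M, hM⟩ := h u₀ hu₀ hdiv hdec
  exact clayR3_solvable_of_bkmClass_vorticityBound hμ hu₀ hdiv hdec hM

/-- **(A) at `μ` from data-only ENSTROPHY bounds in the BKM class on closed slabs.**
[cite: FeffermanClay2006, (A) with (4) (6) (7) p. 2] [cite: Leray1934, §33, §20] -/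
theorem clayR3_regularityAt_of_bkmClass_enstrophyBound (hμ : 0 < μ)
    (h : ∀ (u₀ : EuclideanSpace ℝ (Fin 3) → EuclideanSpace ℝ (Fin 3)), ContDiff ℝ ∞ u₀ →
      NSWave0.IsDivFree u₀ → HasRapidSpatialDecay u₀ →
      ∃ M : ℝ, ∀ T : ℝ, 0 < T → ∀ (u : ℝ → EuclideanSpace ℝ (Fin 3) → EuclideanSpace ℝ (Fin 3))
        (p : ℝ → EuclideanSpace ℝ (Fin 3) → ℝ),
        IsClassicalNSSolutionOn (Icc 0 T) μ 0 u p → u 0 = u₀ → HasBoundedSobolevNormsOn (Icc 0 T) u →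
          ∀ t ∈ Icc 0 T, ∫ x, ‖curl (u t) x‖ ^ 2 ≤ M) :
    clayR3.RegularityAt μ := fun u₀ hu₀ hdiv hdec => by
  obtain ⟨M, hM⟩ := h u₀ hu₀ hdiv hdec
  exact clayR3_solvable_of_bkmClass_enstrophyBound hμ hu₀ hdiv hdec hM

/-- **(A) (every viscosity) from data-only velocity bounds in the BKM class at ONE viscosity `μ > 0`**
(`clayR3_regularityAt_iff`: (A) at one viscosity ⇔ (A)). [cite: FeffermanClay2006, (A) p. 2] [cite: Tao2013Localisation, Rem. 1.2 footnote] -/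
theorem clayR3_regularity_of_bkmClass_velocityBound (hμ : 0 < μ)
    (h : ∀ (u₀ : EuclideanSpace ℝ (Fin 3) → EuclideanSpace ℝ (Fin 3)), ContDiff ℝ ∞ u₀ →
      NSWave0.IsDivFree u₀ → HasRapidSpatialDecay u₀ →
      ∃ M : ℝ, ∀ T : ℝ, 0 < T → ∀ (u : ℝ → EuclideanSpace ℝ (Fin 3) → EuclideanSpace ℝ (Fin 3))
        (p : ℝ → EuclideanSpace ℝ (Fin 3) → ℝ),
        IsClassicalNSSolutionOn (Icc 0 T) μ 0 u p → u 0 = u₀ → HasBoundedSobolevNormsOn (Icc 0 T) u →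
          ∀ t ∈ Icc 0 T, ∀ x, ‖u t x‖ ≤ M) :
    clayR3.Regularity :=
  (clayR3_regularityAt_iff hμ).1 (clayR3_regularityAt_of_bkmClass_velocityBound hμ h)

/-- **(A) from data-only gradient bounds in the BKM class at one viscosity.**
[cite: FeffermanClay2006, (A) p. 2] [cite: BealeKatoMajda1984, Thm. 1 and Corollary] -/
theorem clayR3_regularity_of_bkmClass_gradientBound (hμ : 0 < μ)
    (h : ∀ (u₀ : EuclideanSpace ℝ (Fin 3) → EuclideanSpace ℝ (Fin 3)), ContDiff ℝ ∞ u₀ →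
      NSWave0.IsDivFree u₀ → HasRapidSpatialDecay u₀ →
      ∃ D : ℝ, ∀ T : ℝ, 0 < T → ∀ (u : ℝ → EuclideanSpace ℝ (Fin 3) → EuclideanSpace ℝ (Fin 3))
        (p : ℝ → EuclideanSpace ℝ (Fin 3) → ℝ),
        IsClassicalNSSolutionOn (Icc 0 T) μ 0 u p → u 0 = u₀ → HasBoundedSobolevNormsOn (Icc 0 T) u →
          ∀ t ∈ Icc 0 T, ∀ x, ‖fderiv ℝ (u t) x‖ ≤ D) :
    clayR3.Regularity :=
  (clayR3_regularityAt_iff hμ).1 (clayR3_regularityAt_of_bkmClass_gradientBound hμ h)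

/-- **(A) from data-only vorticity bounds in the BKM class at one viscosity.**
[cite: FeffermanClay2006, (A) p. 2] [cite: BealeKatoMajda1984, Thm. 1 and Corollary] -/
theorem clayR3_regularity_of_bkmClass_vorticityBound (hμ : 0 < μ)
    (h : ∀ (u₀ : EuclideanSpace ℝ (Fin 3) → EuclideanSpace ℝ (Fin 3)), ContDiff ℝ ∞ u₀ →
      NSWave0.IsDivFree u₀ → HasRapidSpatialDecay u₀ →
      ∃ M : ℝ, ∀ T : ℝ, 0 < T → ∀ (u : ℝ → EuclideanSpace ℝ (Fin 3) → EuclideanSpace ℝ (Fin 3))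
        (p : ℝ → EuclideanSpace ℝ (Fin 3) → ℝ),
        IsClassicalNSSolutionOn (Icc 0 T) μ 0 u p → u 0 = u₀ → HasBoundedSobolevNormsOn (Icc 0 T) u →
          ∀ t ∈ Icc 0 T, ∀ x, ‖curl (u t) x‖ ≤ M) :
    clayR3.Regularity :=
  (clayR3_regularityAt_iff hμ).1 (clayR3_regularityAt_of_bkmClass_vorticityBound hμ h)

/-- **(A) from data-only enstrophy bounds in the BKM class at one viscosity.**
[cite: FeffermanClay2006, (A) p. 2] [cite: Leray1934, §33, §20] -/
theorem clayR3_regularity_of_bkmClass_enstrophyBound (hμ : 0 < μ)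
    (h : ∀ (u₀ : EuclideanSpace ℝ (Fin 3) → EuclideanSpace ℝ (Fin 3)), ContDiff ℝ ∞ u₀ →
      NSWave0.IsDivFree u₀ → HasRapidSpatialDecay u₀ →
      ∃ M : ℝ, ∀ T : ℝ, 0 < T → ∀ (u : ℝ → EuclideanSpace ℝ (Fin 3) → EuclideanSpace ℝ (Fin 3))
        (p : ℝ → EuclideanSpace ℝ (Fin 3) → ℝ),
        IsClassicalNSSolutionOn (Icc 0 T) μ 0 u p → u 0 = u₀ → HasBoundedSobolevNormsOn (Icc 0 T) u →
          ∀ t ∈ Icc 0 T, ∫ x, ‖curl (u t) x‖ ^ 2 ≤ M) :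
    clayR3.Regularity :=
  (clayR3_regularityAt_iff hμ).1 (clayR3_regularityAt_of_bkmClass_enstrophyBound hμ h)

end

end Literature.Claims.NS.ClayVariants

-- WHAT THIS IS NOT: not a claim about NS regularity or blow-up; not a claim about any author beyond
-- the typed locator.
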